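import Literature.Probability.LatticeModels.RandomClusterShiftedBoxes
import Literature.Probability.Percolation.LocalLimitMeasure
import HarnessLib

/-!
# FK-continuity transplant, FO-06 (construction half): definitions — cylinder events, the free and
# wired box laws of the random-cluster model on `ℤ^d`, the local-limit predicate and `φ^b_{p,q}`

Cell `fk-continuity` (bschramm), row FO-06 seat B; support file for the FK-continuity transplant
(`--supports stmt-CriticalPhenomena-4575`); builds on p205010 (kernel theorem, internal audit signed;
external expert review pending). Definitions only (plus their unfolding lemmas); the theorems about
them are the companion files `InfiniteVolumeCylinders.lean` (generic local-limit packaging by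
increasing cylinders), `InfiniteVolumeBoxLaws.lean` (Grimmett's (4.24): monotonicity and convergence
of the box laws on increasing cylinders) and `InfiniteVolumeMeasures.lean` (existence and uniqueness
of the limits `φ⁰_{p,q}`, `φ¹_{p,q}`, Grimmett 2006 Thm. (4.19)(a)). General dimension `d`; no named
facts, no sorries, standard axioms.

* `cylEvent E₀ S = {ω | ω ∩ E₀ = S ∩ E₀}` — cylinder events of a configuration space `Set ι`.
* `liftEdges Λ ω` — a bond configuration of the finite piece `Λ ⊆ ℤ^d` read on `ℤ^d` (edges off
  `Λ` closed).
* `boxBC d b n`, `rcBoxMeasure d b p q n`, `rcBoxLaw d b p q n` — the boundary condition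
  (`b = false`: free, Grimmett's `ξ = 0`; `b = true`: `∂Λ_n` wired, `ξ = 1`), the random-cluster
  measure `φ^b_{Λ_n,p,q}` of the box graph `(Λ_n, E_{Λ_n})`, `Λ_n = [-n,n]^d` (the tree's `rcMeasure`
  of `finsetGraph (zdGraph d) (box d n)`; for `b = true` definitionally the measure behind the
  tree's `thetaWiredBox`, for `b = false` the one behind `thetaFreeBox`/`boxFreeReal`), and its
  push-forward to bond configurations of `ℤ^d`. [cite: Grimmett2006, §4.2 (4.11)–(4.12)]
* `IsBoxLimit d b p q P` — `P` is a probability measure on bond configurations of `ℤ^d` and, for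
  every local event `A`, `φ^b_{Λ_n,p,q}(A) → P(A)`: `P` is the weak limit `φ^b_{p,q} = lim_{Λ_n ↑ ℤ^d}
  φ^b_{Λ_n,p,q}` of Grimmett 2006 Thm. (4.19)(a) (free for `b = false`, wired for `b = true`).
  [cite: Grimmett2006, Thm. (4.19)(a)]
* `rcLimit d b p q` — THE infinite-volume random-cluster measure `φ^b_{p,q}` on `ℤ^d`: the box limit
  when one exists (it does for `0 ≤ p ≤ 1`, `q ≥ 1`, and is unique: `InfiniteVolumeMeasures.lean`),
  the point mass at the empty configuration otherwise (junk value).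

## References

* G. Grimmett, *The Random-Cluster Model*, Springer 2006: §4.1 (cylinder σ-field), §4.2
  (4.11)–(4.12), §4.3, Thm. (4.19)(a). [Grimmett2006]
-/

noncomputable section

open MeasureTheory Set Filter
open scoped Topology ENNReal

namespace Summit.CriticalPhenomena.PercolationContinuityZ3.Theorems.FK

open Literature.Probability.Percolation Literature.Probability.LatticeModels

/-! ### Cylinder events on a configuration space `Set ι` -/

section Cylinder

variable {ι : Type*}

/-- The cylinder event prescribing the configuration on the finite set `E₀` of coordinates:
"`ω ∩ E₀ = S ∩ E₀`". [cite: Grimmett2006, §4.1 (the σ-field generated by finite-dimensional cylinders)] -/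
def cylEvent (E₀ S : Finset ι) : Set (Set ι) := {ω | ∀ i ∈ E₀, (i ∈ ω ↔ i ∈ S)}

/-- Membership in `cylEvent`. [cite: Grimmett2006, §4.1] -/
@[simp] theorem mem_cylEvent_iff {E₀ S : Finset ι} {ω : Set ι} :
    ω ∈ cylEvent E₀ S ↔ ∀ i ∈ E₀, (i ∈ ω ↔ i ∈ S) := Iff.rfl

end Cylinder

/-! ### The free and wired box laws of the random-cluster model on `ℤ^d` -/

section BoxLaws

variable {d : ℕ}

/-- Lift a bond configuration of a finite piece `Λ ⊆ ℤ^d` (vertex type `↥Λ`) to a bond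
configuration of `ℤ^d`: the image under `Sym2.map Subtype.val` (edges off `Λ` closed).
[cite: Grimmett2006, §4.2 (configurations on E_Λ, extended by 0 off Λ)] -/
def liftEdges (Λ : Finset (Site d)) (ω : BondConfig ↥Λ) : BondConfig (Site d) :=
  Sym2.map Subtype.val '' ω

/-- Membership in the lifted configuration. [cite: Grimmett2006, §4.2] -/
theorem mem_liftEdges_iff {Λ : Finset (Site d)} {ω : BondConfig ↥Λ} {e : Sym2 (Site d)} :
    e ∈ liftEdges Λ ω ↔ ∃ e' ∈ ω, Sym2.map Subtype.val e' = e := Iff.rfl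

variable (d)

/-- The boundary condition of the box `Λ_n`, as the set of wired vertices: `b = false` (Grimmett's
`ξ = 0`, free) wires nothing, `b = true` (`ξ = 1`, wired) wires the inner vertex boundary `∂Λ_n`.
[cite: Grimmett2006, §4.2 (4.11)–(4.12), ξ ∈ {0,1}] -/
def boxBC (b : Bool) (n : ℕ) : Set ↥(box d n) :=
  bif b then wiredBoundary (zdGraph d) (box d n) else ∅

/-- **The box measure `φ^b_{Λ_n,p,q}`**: the random-cluster measure of the box graph
`(Λ_n, E_{Λ_n})`, `Λ_n = [-n,n]^d ⊆ ℤ^d`, with boundary condition `b` (free for `b = false`, wired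
for `b = true`), on bond configurations of `Λ_n`. [cite: Grimmett2006, §4.2 (4.11)–(4.12)] -/
def rcBoxMeasure (b : Bool) (p q : ℝ) (n : ℕ) : Measure (BondConfig ↥(box d n)) :=
  rcMeasure (finsetGraph (zdGraph d) (box d n)) p q (boxBC d b n)

/-- **The box law on `ℤ^d`**: `φ^b_{Λ_n,p,q}` pushed forward to bond configurations of `ℤ^d` (edges
off `Λ_n` closed). [cite: Grimmett2006, §4.2 (4.11)–(4.12) and §4.3 (weak limits on Ω)] -/
def rcBoxLaw (b : Bool) (p q : ℝ) (n : ℕ) : Measure (BondConfig (Site d)) :=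
  (rcBoxMeasure d b p q n).map (liftEdges (box d n))

/-- **`P` is the infinite-volume random-cluster measure `φ^b_{p,q}` on `ℤ^d`** (`b = false`: free,
`b = true`: wired), stated as a property: `P` is a probability measure on bond configurations of
`ℤ^d` and the box laws `φ^b_{Λ_n,p,q}` converge to `P` on every local event (event depending on
finitely many edges) as `Λ_n = [-n,n]^d ↑ ℤ^d` — the weak limit of Grimmett 2006, Thm. (4.19)(a).
For `0 ≤ p ≤ 1`, `q ≥ 1` such a `P` exists and is unique (`InfiniteVolumeMeasures.lean`).
[cite: Grimmett2006, Thm. (4.19)(a)] -/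
structure IsBoxLimit (b : Bool) (p q : ℝ) (P : Measure (BondConfig (Site d))) : Prop where
  /-- `P` is a probability measure. -/
  isProbabilityMeasure : IsProbabilityMeasure P
  /-- Local-event probabilities converge: `φ^b_{Λ_n,p,q}(A) → P(A)`. -/
  tendsto_of_isLocalEvent : ∀ A : Set (BondConfig (Site d)), IsLocalEvent A →
    Tendsto (fun n : ℕ => rcBoxLaw d b p q n A) atTop (𝓝 (P A))

open Classical in
/-- **The infinite-volume random-cluster measure `φ^b_{p,q}` on `ℤ^d`** (`b = false`: `φ⁰_{p,q}`,
`b = true`: `φ¹_{p,q}`): the local limit of the box laws `φ^b_{Λ_n,p,q}` when one exists — it does,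
uniquely, for `0 ≤ p ≤ 1`, `q ≥ 1` (Grimmett 2006, Thm. (4.19)(a); `isBoxLimit_rcLimit`,
`IsBoxLimit.unique` in `InfiniteVolumeMeasures.lean`) — and the point mass at the empty
configuration otherwise (junk value). [cite: Grimmett2006, Thm. (4.19)(a)] -/
def rcLimit (b : Bool) (p q : ℝ) : Measure (BondConfig (Site d)) :=
  if h : ∃ P : Measure (BondConfig (Site d)), IsBoxLimit d b p q P then h.choose
  else Measure.dirac (∅ : BondConfig (Site d))

variable {d}

/-- When a box limit exists, `rcLimit` is one. [cite: Grimmett2006, Thm. (4.19)(a)] -/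
theorem isBoxLimit_rcLimit_of_exists {b : Bool} {p q : ℝ}
    (h : ∃ P : Measure (BondConfig (Site d)), IsBoxLimit d b p q P) :
    IsBoxLimit d b p q (rcLimit d b p q) := by
  classical
  rw [rcLimit, dif_pos h]
  exact h.choose_spec

/-- The free box measure, unfolded. [cite: Grimmett2006, §4.2 (4.11)–(4.12), ξ = 0] -/
theorem rcBoxMeasure_false (p q : ℝ) (n : ℕ) :
    rcBoxMeasure d false p q n = rcMeasure (finsetGraph (zdGraph d) (box d n)) p q ∅ := rfl

/-- The wired box measure, unfolded. [cite: Grimmett2006, §4.2 (4.11)–(4.12), ξ = 1] -/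
theorem rcBoxMeasure_true (p q : ℝ) (n : ℕ) :
    rcBoxMeasure d true p q n =
      rcMeasure (finsetGraph (zdGraph d) (box d n)) p q (wiredBoundary (zdGraph d) (box d n)) := rfl

end BoxLaws

end Summit.CriticalPhenomena.PercolationContinuityZ3.Theorems.FK

end
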